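import Literature.MathematicalPhysics.QuantumFieldTheory.Balaban1983to89.B9BlockKeyTransferXSK
import Literature.MathematicalPhysics.QuantumFieldTheory.Balaban1983to89.B9WalkLettersOpsO

/-!
# `Balaban1983to89.B9Local342AtOpsWalkYO` — T. Bałaban, *Propagators for lattice gauge theories in a background field*, Commun. Math. Phys. **99** (1985) 389–434
# [Balaban1985BackgroundPropagators], Cor. 3.6 p. 408 + (3.87)–(3.90) p. 409, with [4] = *Propagators and renormalization transformations … II*, CMP **96** (1984)
# [Balaban1984PropagatorsII], (2.51) p. 232: THE ROWS-18 FACE OF THE pub-ymgap N06 CERTIFICATE AT dag-n06-d's GENERIC-LETTER WALK RECORD `opsWalkYO … O` — `Local342` from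
# BLOCK-KEYED (3.42) tables of ANY cube-letter family `O □` (all members, no section); the one-line generalisation of `B9BlockKeyTransferXSK.local342_opsWalkY_of_blocks`
# that lets the certificate's cube-letter slot be re-pinned to the (R)-design letter `locLetterY` (whose tables are `B9Cor36GpCubeLocAtBlocks.hasMajorant_locLetterY_blocks`)

statement-level skeleton of published theorems with citation tags; proofs where landed; nothing here is a claim about the Yang–Mills mass gap

**The print.** [B9] p. 409 l. 1–5 (the operators `G′_□(U)` of the cube's own sequence «satisfy all the inequalities of Theorems 3.1–3.3»); (3.87) p. 409 «G′₀ = Σ_{□∈𝒟} h_□G′_□h_□»;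
(3.42) p. 397 («y, y′ ∈ 𝔅»); [4] (2.51) p. 232, (2.45)–(2.46) p. 231, (2.54) p. 233.

**Why this file (pub-ymgap node N06 [B9], rows 18; dag-lead WORDS 333 (α), 2026-08-30).**  dag-n06-d's `B9WalkLettersOpsO.opsWalkYO x b B cfg parS bI O` is the rows-18 walk
record with the cube-letter slot `Gsq U □ := GcoS … (O □) U` left FREE (`opsWalkYO … (fun □ => GsqY … (cubeDomY x □)) = opsWalkY` by `rfl`), so that the N06 certificate's slot can be
re-pinned by `rfl` to any letter for which Cor. 3.6 holds.  THIS FILE is the rows-18 face at that record: ★★ `local342_opsWalkYO_of_blocks` — dag-n06-c's T1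
(`B9Local342OfBlocksXSK` §2, generic in the letter) composed with T2's key transfer (`B9BlockKeyTransferXSK.hasMajorant_blkSK_of_blkOfSK`), the record's pins being `rfl`.
PROOF = `local342_opsWalkY_of_blocks` verbatim with the letter left generic.

HONEST SCOPE.  Finite bookkeeping over landed theorems; the block tables, the two laws and the count are HYPOTHESES; nothing of [B9] Cor. 3.6 asserted; count-neutral; rows 18 NOT
thereby derived at the (R)-design letter until the certificate re-pins its slot; N06 NOT discharged; nothing continuum ∕ OS ∕ mass gap ∕ Clay.  Cell `pub-ymgap` (D-0062), seat
`pub-ymgap-dag-n06-c` (gen 23).  NEW file; 1 theorem + 2 private kernel rewrites, 0 `def`, no `sorry`, no `axiom`, no `instance`, no `notation`.  `--supports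
stmt-QuantumFields-27364`.  Net new unproved facts: 0.

RELATED IN THE TREE, NOT DUPLICATED: `B9BlockKeyTransferXSK.local342_opsWalkY_of_blocks` (the instance `O := GsqY`; kept — the certificate of record ED.115 «VQ» reads it),
`B9Local342OfBlocksXSK.local342_of_blocks_pins` (block-keyed records), `B9WalkLettersOpsO` (the record; pins USED as `rfl`).
-/

noncomputable section

namespace Literature.MathematicalPhysics.QuantumFieldTheory.Balaban1983to89.B9Local342AtOpsWalkYO

open Node00 (SiteY FBondY IBondY CfgY SiteOpY SiteParY UboxY shiftY etaS lapS)
open B6Geom246MultiLevelBox (blkOf)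
open B6Ineq2142KLevelV1 (β)
open B6KLevelCensusIndexV1 (KIdx)
open B6Cover236MultiLevelBlocks (cubes)
open B6RandomWalk (HasMajorant BlockSupp)
open B6RandomWalkHom (HasMajorantHom)
open B9Thm34Ext (toB6)
open B9GeoNormsKLevelV1 (geo9K)
open B9PinMembersKLevelV1 (MemberY geo9Y)
open B9SectBAllBlocksGeometryY (geoBK geoBY)
open B9RWSumsReadsNbr (nbr)
open B9Eq352DivFormLetters (conj)
open B9Eq352GradLetters (diffLetter)
open B9Thm39ReadingCoords (cR39 cR39_nonneg)
open B9CoReadingCoordsS (XSK blkSK sIK GcoS DcoS DscoS LcoS)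
open Node00.OpsYBlockPinOfRecord (blkOfSK)
open B9Local342OfBlocksXSK (hasMajorant_GcoS_of_blocks hasMajorantHom_DcoS_GcoS_of_blocks hasMajorantHom_GcoS_DscoS_of_blocks hasMajorantHom_LcoS_GcoS_of_blocks)
open B9BlockKeyTransferXSK (hasMajorant_blkSK_of_blkOfSK hasMajorantHom_blkSK_of_blkOfSK)
open B9Thm37Whole (Ops Local342)
open B9WalkLettersOpsO (opsWalkYO)

variable {d ℓ : ℕ} {hd : 1 ≤ d + 1} {hL : Odd (ℓ + 1) ∧ 1 < ℓ + 1} {b₀ b₁ : ℝ}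
variable {κ : Type}

/-! ## The rows-18 face at dag-n06-d's GENERIC-LETTER record `opsWalkYO … O` -/

section Record

variable [Fintype κ] {𝔸 : Type} [NormedRing 𝔸] [NormedAlgebra ℂ 𝔸] [CompleteSpace 𝔸] [FiniteDimensional ℝ 𝔸]
variable {Mstar : ℕ} (x : MemberY d ℓ hd hL b₀ b₁ Mstar) [Fintype (geo9Y x).Site] [Fintype (geoBY x).Site] (b : Module.Basis κ ℝ 𝔸)
variable (B : B9.Backgrounds) (cfg : B.Cfg → CfgY 𝔸 x.toKIdx) (parS : SiteParY 𝔸 x.toKIdx) (bI : FBondY x.toKIdx → IBondY x.toKIdx)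
variable {R₀ : ℝ} {H₀ : Prop} {U₁ : B.Cfg}

section KShape

variable {G : B6.Geometry} {X Y : Type}

/-- a block majorant with its kernel rewritten. [folklore] -/
private theorem hasMajorant_congrK {blk : X → G.Site} {T : Module.End ℝ (X → ℝ)} {K K' : G.Site → G.Site → ℝ} (hK : K = K')
    (h : HasMajorant (g := G) blk T K) : HasMajorant (g := G) blk T K' := by
  subst hK; exact h

/-- a two-block majorant with its kernel rewritten. [folklore] -/
private theorem hasMajorantHom_congrK {blkX : X → G.Site} {blkY : Y → G.Site} {T : (X → ℝ) →ₗ[ℝ] (Y → ℝ)} {K K' : G.Site → G.Site → ℝ} (hK : K = K')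
    (h : HasMajorantHom (g := G) blkX blkY T K) : HasMajorantHom (g := G) blkX blkY T K' := by
  subst hK; exact h

end KShape

/-- ★★ **THE ROWS-18 FACE AT THE GENERIC-LETTER RECORD, ALL MEMBERS, NO SECTION** — the `Local342` conjunct of the N06 certificate's rows 18 from BLOCK-KEYED (3.42) tables, for
ANY cube letter `O □`: at dag-n06-d's record `opsWalkYO x b B cfg parS bI O` (`blk = blkY = blkSK (sIK bI)`, `Gsq U □ = GcoS … (O □) U`, `D ∕ Dstar ∕ Lap = DcoS ∕ DscoS ∕ LcoS`, all
`rfl`), the four block tables h0–h3 of the cube letters over the all-blocks geometry `toB6 (geoBY x) R H` keyed by `Δ(·)` (`G □ = η²O_□(U)`, `L = η⁻²Δ_U`, one pair `(B_c, δ)`, `0 ≤ B_c`,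
`0 ≤ δ` — e.g. dag-n06-c's `B9Cor36GpCubeLocAtBlocks.hasMajorant_locLetterY_blocks` at the (R)-design letter `O □ := locLetterY …`, `G □ := Gmem …`), the two laws of `bI` (node00-def-Y's
`dist_beta_blkSK_sIK_bIYOfRecord_le_one` ∕ `len_blkSK_sIK_bIYOfRecord_eq` at the record's `bI`) and a block count `N₁` give `Local342 (opsWalkYO x b B cfg parS bI O) R H
(N₁·e^{2δ}·(c_R·B_c)) δ U` — rate KEPT, every factor in the constant (`B9BlockKeyTransferXSK.local342_opsWalkY_of_blocks` is the instance `O □ := GsqY … (cubeDomY x □)`).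
[cite: Balaban1985BackgroundPropagators, Cor. 3.6 p.408 + p.409, (3.42) p.397, (3.87) p.409; Balaban1984PropagatorsII, (2.51) p.232, (2.54) p.233, (2.45)–(2.46) p.231] -/
theorem local342_opsWalkYO_of_blocks (O : ↥(cubes x.toKIdx.D.toDomains) → SiteOpY 𝔸 x.toKIdx)
    (hβ1 : ∀ p : XSK κ x.toKIdx, (geoBY x).dist (β x.toKIdx.hN x.toKIdx.D x.toKIdx.hk (blkSK x.toKIdx (sIK x.toKIdx bI) p)) (blkOfSK κ x.toKIdx p) ≤ 1)
    (hlen : ∀ p : XSK κ x.toKIdx, (geo9Y x).len (blkSK x.toKIdx (sIK x.toKIdx bI) p) = (geoBY x).len (blkOfSK κ x.toKIdx p))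
    {N₁ : ℝ} (hN : ∀ t : (geoBY x).Site, ((nbr (geoBY x) 1 t).card : ℝ) ≤ N₁)
    {η : ℝ} (hη : η = etaS x.toKIdx) {Uc : Fin (d + 1) → SiteY x.toKIdx → 𝔸ˣ} (hUc : Uc = UboxY x.toKIdx (cfg U₁))
    (G : ↥(cubes x.toKIdx.D.toDomains) → Module.End ℝ (SiteY x.toKIdx → 𝔸)) (L : Module.End ℝ (SiteY x.toKIdx → 𝔸))
    (hG : ∀ c Λ, G c Λ = (η ^ 2) • O c (cfg U₁) Λ) (hL : ∀ Λ, L Λ = (η ^ 2)⁻¹ • lapS x.toKIdx (cfg U₁) Λ)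
    {Bc δ : ℝ} (hBc : 0 ≤ Bc) (hδ : 0 ≤ δ)
    (h0 : ∀ c, HasMajorant (g := toB6 (geoBY x) R₀ H₀) (fun p : SiteY x.toKIdx × κ => blkOf x.toKIdx.D.toDomains p.1) (conj b (G c))
      (fun s s' => Bc * (geoBY x).len s ^ 2 * Real.exp (-(δ * (geoBY x).dist s s'))))
    (h1 : ∀ c (μ : Fin (d + 1)), HasMajorant (g := toB6 (geoBY x) R₀ H₀) (fun p : SiteY x.toKIdx × κ => blkOf x.toKIdx.D.toDomains p.1)
      (conj b (diffLetter (shiftY x.toKIdx) Uc (((η : ℂ))⁻¹) (Sum.inl μ)) * conj b (G c))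
      (fun s s' => Bc * (geoBY x).len s * Real.exp (-(δ * (geoBY x).dist s s'))))
    (h2 : ∀ c (μ : Fin (d + 1)), HasMajorant (g := toB6 (geoBY x) R₀ H₀) (fun p : SiteY x.toKIdx × κ => blkOf x.toKIdx.D.toDomains p.1)
      (conj b (G c) * conj b (diffLetter (shiftY x.toKIdx) Uc (((η : ℂ))⁻¹) (Sum.inr μ)))
      (fun s s' => Bc * (geoBY x).len s * Real.exp (-(δ * (geoBY x).dist s s'))))
    (h3 : ∀ c, HasMajorant (g := toB6 (geoBY x) R₀ H₀) (fun p : SiteY x.toKIdx × κ => blkOf x.toKIdx.D.toDomains p.1) (conj b L * conj b (G c))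
      (fun s s' => Bc * 1 * Real.exp (-(δ * (geoBY x).dist s s')))) :
    Local342 (opsWalkYO x b B cfg parS bI O) R₀ H₀ (N₁ * Real.exp (2 * δ) * (cR39 b * Bc)) δ U₁ := by
  letI : Fintype (geoBK x.toKIdx).Site := (inferInstance : Fintype (geoBY x).Site)
  letI : Fintype (geo9K x.toKIdx).Site := (inferInstance : Fintype (geo9Y x).Site)
  have hC : 0 ≤ cR39 b * Bc := mul_nonneg (cR39_nonneg b) hBc
  -- block-keyed entries (T1), kernels reshaped to `C·ℓⁿ·e^{−δd}`
  have e0 : ∀ c, HasMajorant (g := toB6 (geoBK x.toKIdx) R₀ H₀) (blkOfSK κ x.toKIdx) (GcoS x.toKIdx b B cfg (O c) U₁)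
      (fun s s' => cR39 b * Bc * (geoBK x.toKIdx).len s ^ 2 * Real.exp (-(δ * (geoBK x.toKIdx).dist s s'))) := fun c =>
    hasMajorant_congrK (by
        funext s s'
        show cR39 b * (Bc * (geoBK x.toKIdx).len s ^ 2 * Real.exp (-(δ * (geoBK x.toKIdx).dist s s'))) = _
        ring)
      (hasMajorant_GcoS_of_blocks x.toKIdx b B cfg (O c) (R₀ := R₀) (H₀ := H₀) hη (G c) (hG c) (h0 c))
  have e1 : ∀ c, HasMajorantHom (g := toB6 (geoBK x.toKIdx) R₀ H₀) (blkOfSK κ x.toKIdx) (blkOfSK κ x.toKIdx)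
      (DcoS x.toKIdx b B cfg U₁ ∘ₗ GcoS x.toKIdx b B cfg (O c) U₁)
      (fun s s' => cR39 b * Bc * (geoBK x.toKIdx).len s ^ 1 * Real.exp (-(δ * (geoBK x.toKIdx).dist s s'))) := fun c =>
    hasMajorantHom_congrK (by
        funext s s'
        show cR39 b * (Bc * (geoBK x.toKIdx).len s * Real.exp (-(δ * (geoBK x.toKIdx).dist s s'))) = _
        ring)
      (hasMajorantHom_DcoS_GcoS_of_blocks x.toKIdx b B cfg (O c) (R₀ := R₀) (H₀ := H₀) hη hUc (G c) (hG c) (h1 c))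
  have e2 : ∀ c, HasMajorantHom (g := toB6 (geoBK x.toKIdx) R₀ H₀) (blkOfSK κ x.toKIdx) (blkOfSK κ x.toKIdx)
      (GcoS x.toKIdx b B cfg (O c) U₁ ∘ₗ DscoS x.toKIdx b B cfg U₁)
      (fun s s' => cR39 b * Bc * (geoBK x.toKIdx).len s ^ 1 * Real.exp (-(δ * (geoBK x.toKIdx).dist s s'))) := fun c =>
    hasMajorantHom_congrK (by
        funext s s'
        show cR39 b * (Bc * (geoBK x.toKIdx).len s * Real.exp (-(δ * (geoBK x.toKIdx).dist s s'))) = _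
        ring)
      (hasMajorantHom_GcoS_DscoS_of_blocks x.toKIdx b B cfg (O c) (R₀ := R₀) (H₀ := H₀) hη hUc (G c) (hG c) (h2 c))
  have e3 : ∀ c, HasMajorantHom (g := toB6 (geoBK x.toKIdx) R₀ H₀) (blkOfSK κ x.toKIdx) (blkOfSK κ x.toKIdx)
      (LcoS x.toKIdx b B cfg U₁ ∘ₗ GcoS x.toKIdx b B cfg (O c) U₁)
      (fun s s' => cR39 b * Bc * (geoBK x.toKIdx).len s ^ 0 * Real.exp (-(δ * (geoBK x.toKIdx).dist s s'))) := fun c =>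
    hasMajorantHom_congrK (by
        funext s s'
        show cR39 b * (Bc * 1 * Real.exp (-(δ * (geoBK x.toKIdx).dist s s'))) = _
        ring)
      (hasMajorantHom_LcoS_GcoS_of_blocks x.toKIdx b B cfg (O c) (R₀ := R₀) (H₀ := H₀) hη (G c) L (hG c) hL (h3 c))
  -- transfer to the index key (T2a) — the record's pins are `rfl`
  refine ⟨fun c => ?_, fun c => ?_, fun c => ?_, fun c => ?_⟩
  · exact hasMajorant_blkSK_of_blkOfSK x.toKIdx bI (R₀ := R₀) (H₀ := H₀) hβ1 hlen hN hC hδ 2 (e0 c)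
  · exact hasMajorantHom_congrK (funext fun y => funext fun y' => by rw [pow_one]; rfl)
      (hasMajorantHom_blkSK_of_blkOfSK x.toKIdx bI (R₀ := R₀) (H₀ := H₀) hβ1 hlen hN hC hδ 1 (e1 c))
  · exact hasMajorantHom_congrK (funext fun y => funext fun y' => by rw [pow_one]; rfl)
      (hasMajorantHom_blkSK_of_blkOfSK x.toKIdx bI (R₀ := R₀) (H₀ := H₀) hβ1 hlen hN hC hδ 1 (e2 c))
  · exact hasMajorantHom_congrK (funext fun y => funext fun y' => by rw [pow_zero, mul_one]; rfl)
      (hasMajorantHom_blkSK_of_blkOfSK x.toKIdx bI (R₀ := R₀) (H₀ := H₀) hβ1 hlen hN hC hδ 0 (e3 c))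

end Record

end Literature.MathematicalPhysics.QuantumFieldTheory.Balaban1983to89.B9Local342AtOpsWalkYO

end
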